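import Summits.CriticalPhenomena.PercolationContinuityZ3.Theorems.PercNearOneGluingNoHeavyLowerTailSunflowerCloneHqt
import Summits.CriticalPhenomena.PercolationContinuityZ3.Theorems.PercNearOneGluingNoHeavyLowerTailSunflowerPrincipalCore
import Summits.CriticalPhenomena.PercolationContinuityZ3.Theorems.PercNearOneGluingNoHeavyLowerTailCovKLInduction
import HarnessLib.Audit

/-!
# `NoHeavyLowerTail` (crux stmt-CriticalPhenomena-4575), abstract sunflower cubic at LAW level: the ONE-COORDINATE
# (Bernstein) DECOMPOSITION of `6H` along a deletion–contraction pencil, the closed form of the mixed coefficients, and the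
# ONE-STEP lemma `h₀, h₁, h₂, h₃ ≥ 0 ⟹ 6H(F, p) ≥ 0`

Support file (seat `prim-ineq-gen-2` gen 28; `--supports stmt-CriticalPhenomena-4575`).  Nothing is asserted about the crux; no
`sorry`, no named facts, standard axioms.  Memo: run/shared/lean/prim/prim-ineq-gen-2/LAW-INDUCTION-GEN28.md §2.

SETTING.  `μ = prodBernoulli p` on `Set ι`, `ι` finite; a three-petal sunflower of up-sets `E₁ ∩ E₂ = E₁ ∩ E₃ = E₂ ∩ E₃ = A`;
CELL VECTOR `m = cellVec p = (b, c₁, c₂, c₃, a) : Fin 5 → ℝ` (index `0` = bottom `(E₁ ∪ E₂ ∪ E₃)ᶜ`, `i = 1,2,3` = petal `E_i ∖ A`,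
`4` = top `A` — the label convention of `SunflowerPartition.s6H`).  The symmetric trilinear form of the kernel `s6H`,
`triH u v w = Σ_{x,y,z} u_x v_y w_z · s6H x y z`, has diagonal `triH m m m = 6·H(m) = 6[(a+b)(ab − e₂(c)) − e₃(c)]`
(`triH_self_eq`; the lane's law-level conjecture H-COMB, INEQ-CLAIMS l.1060, is `H ≥ 0` for every product measure).

RESULTS (all [this work]):
* `triH_mixed_eq` — CLOSED FORM of the mixed value: `triH u m m = 2·⟨u, ∇H(m)⟩`, i.e.
  `2[u₄(2ab + b² − e₂) + u₀(2ab + a² − e₂) − Σ_i u_i((a+b)(c_j + c_k) + c_j c_k)]`.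
* `triH_bernstein` — along `m_t = (1−t)m₀ + t m₁`:
  `triH m_t m_t m_t = (1−t)³·triH m₀³ + 3t(1−t)²·triH m₁ m₀ m₀ + 3t²(1−t)·triH m₁ m₁ m₀ + t³·triH m₁³`.
* `cellVec_oneBond` — for a coordinate `e` with `t = p e`: `cellVec p = (1−t)·cellVec (p[e↦0]) + t·cellVec (p[e↦1])`
  (`prodBernoulli_real_oneBond`), hence `lawTriH_bernstein`: the law-level cubic `6H(F, p)` is the cubic Bernstein polynomial with
  control values `h₀ = 6H(F∖e)`, `h₁ = triH m₁ m₀ m₀`, `h₂ = triH m₁ m₁ m₀`, `h₃ = 6H(F/e)` (`m₀, m₁` the cell vectors under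
  `p[e↦0]`, `p[e↦1]`).
* `lawTriH_nonneg_of_step` — THE ONE-STEP LEMMA: if `h₀, h₁, h₂, h₃ ≥ 0` then `6H(F, p) ≥ 0`.  With the typed conjecture
  `LawMixedNonneg` (both mixed coefficients are nonnegative for every finite three-petal sunflower, every `p` and every `e` — the
  law-level, one-coordinate instance of prim-l12-p2's Conjecture G; numerically clean, memo §6; PROVED when `{e} ∈ E₁ ∪ E₂ ∪ E₃`
  in the companion `…SunflowerLawMarkedPoint`) this is the inductive step of "H-COMB for all finite product measures" by
  induction on the number of coordinates with `p e ∉ {0, 1}` (the assembly with the Dirac base case is left to the companion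
  files; this file provides the step and the bookkeeping).
-/

noncomputable section

namespace Summit.CriticalPhenomena.PercolationContinuityZ3.Theorems.SunflowerPartition

namespace LawOneStep

open MeasureTheory Finset
open Literature.Probability.LatticeModels Literature.Probability.Percolation

variable {ι : Type*}

/-! ## The trilinear form of `s6H` -/

/-- The symmetric trilinear form of the kernel `s6H` on cell vectors `Fin 5 → ℝ`. [this work] -/
def triH (u v w : Fin 5 → ℝ) : ℝ := ∑ x : Fin 5, ∑ y : Fin 5, ∑ z : Fin 5, u x * v y * w z * s6Hr x y z

/-- Diagonal of the trilinear form: `triH m m m = 6·H(m)`. [this work] -/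
theorem triH_self_eq (m : Fin 5 → ℝ) :
    triH m m m = 6 * ((m 4 + m 0) * (m 4 * m 0 - (m 1 * m 2 + m 1 * m 3 + m 2 * m 3)) - m 1 * m 2 * m 3) := by
  simp only [triH, s6Hr, s6H_table, Fin.sum_univ_five]
  simp only [Matrix.cons_val_zero, Matrix.cons_val_one, Matrix.cons_val]
  norm_num
  ring

/-- **Closed form of the mixed value**: `triH u m m = 2⟨u, ∇H(m)⟩`. [this work] -/
theorem triH_mixed_eq (u m : Fin 5 → ℝ) :
    triH u m m = 2 * (u 4 * (2 * m 4 * m 0 + m 0 ^ 2 - (m 1 * m 2 + m 1 * m 3 + m 2 * m 3))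
      + u 0 * (2 * m 4 * m 0 + m 4 ^ 2 - (m 1 * m 2 + m 1 * m 3 + m 2 * m 3))
      - u 1 * ((m 4 + m 0) * (m 2 + m 3) + m 2 * m 3)
      - u 2 * ((m 4 + m 0) * (m 1 + m 3) + m 1 * m 3)
      - u 3 * ((m 4 + m 0) * (m 1 + m 2) + m 1 * m 2)) := by
  simp only [triH, s6Hr, s6H_table, Fin.sum_univ_five]
  simp only [Matrix.cons_val_zero, Matrix.cons_val_one, Matrix.cons_val]
  norm_num
  ring

/-- **Bernstein decomposition** of the cubic along the pencil `m_t = (1 − t)·m₀ + t·m₁`. [this work] -/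
theorem triH_bernstein (m₀ m₁ : Fin 5 → ℝ) (t : ℝ) :
    triH (fun x => (1 - t) * m₀ x + t * m₁ x) (fun x => (1 - t) * m₀ x + t * m₁ x) (fun x => (1 - t) * m₀ x + t * m₁ x) =
      (1 - t) ^ 3 * triH m₀ m₀ m₀ + 3 * t * (1 - t) ^ 2 * triH m₁ m₀ m₀ + 3 * t ^ 2 * (1 - t) * triH m₁ m₁ m₀ +
        t ^ 3 * triH m₁ m₁ m₁ := by
  simp only [triH, s6Hr, s6H_table, Fin.sum_univ_five]
  simp only [Matrix.cons_val_zero, Matrix.cons_val_one, Matrix.cons_val]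
  norm_num
  ring

/-- `triH_bernstein` with the pencil given pointwise. [this work] -/
theorem triH_bernstein' (m m₀ m₁ : Fin 5 → ℝ) (t : ℝ) (hm : ∀ x, m x = (1 - t) * m₀ x + t * m₁ x) :
    triH m m m =
      (1 - t) ^ 3 * triH m₀ m₀ m₀ + 3 * t * (1 - t) ^ 2 * triH m₁ m₀ m₀ + 3 * t ^ 2 * (1 - t) * triH m₁ m₁ m₀ +
        t ^ 3 * triH m₁ m₁ m₁ := by
  have : m = fun x => (1 - t) * m₀ x + t * m₁ x := funext hm
  subst this
  exact triH_bernstein m₀ m₁ t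

/-- The one-step positivity: nonnegative Bernstein control values give a nonnegative cubic on `[0, 1]`. [this work] -/
theorem triH_pencil_nonneg (m₀ m₁ : Fin 5 → ℝ) {t : ℝ} (ht0 : 0 ≤ t) (ht1 : t ≤ 1)
    (h0 : 0 ≤ triH m₀ m₀ m₀) (h1 : 0 ≤ triH m₁ m₀ m₀) (h2 : 0 ≤ triH m₁ m₁ m₀) (h3 : 0 ≤ triH m₁ m₁ m₁) :
    0 ≤ triH (fun x => (1 - t) * m₀ x + t * m₁ x) (fun x => (1 - t) * m₀ x + t * m₁ x)
      (fun x => (1 - t) * m₀ x + t * m₁ x) := by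
  rw [triH_bernstein]
  have ht' : 0 ≤ 1 - t := by linarith
  have e1 := mul_nonneg (pow_nonneg ht' 3) h0
  have e2 := mul_nonneg (mul_nonneg (mul_nonneg (by norm_num : (0:ℝ) ≤ 3) ht0) (pow_nonneg ht' 2)) h1
  have e3 := mul_nonneg (mul_nonneg (mul_nonneg (by norm_num : (0:ℝ) ≤ 3) (pow_nonneg ht0 2)) ht') h2
  have e4 := mul_nonneg (pow_nonneg ht0 3) h3
  linarith

/-! ## Cell vectors of a sunflower under `prodBernoulli` -/

/-- The cell vector `(b, c₁, c₂, c₃, a)` of the sunflower `(E₁, E₂, E₃; A)` under `prodBernoulli q`. [this work] -/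
def cellVec (q : ι → unitInterval) (E₁ E₂ E₃ A : Set (Set ι)) : Fin 5 → ℝ :=
  ![(prodBernoulli q).real (E₁ ∪ E₂ ∪ E₃)ᶜ, (prodBernoulli q).real (E₁ \ A), (prodBernoulli q).real (E₂ \ A),
    (prodBernoulli q).real (E₃ \ A), (prodBernoulli q).real A]

/-- The law-level cubic `6H(F, q)` as the diagonal of the trilinear form. [this work] -/
def lawTriH (q : ι → unitInterval) (E₁ E₂ E₃ A : Set (Set ι)) : ℝ :=
  triH (cellVec q E₁ E₂ E₃ A) (cellVec q E₁ E₂ E₃ A) (cellVec q E₁ E₂ E₃ A)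

/-- `6H(F, q)` written out in the cells. [this work] -/
theorem lawTriH_eq (q : ι → unitInterval) (E₁ E₂ E₃ A : Set (Set ι)) :
    lawTriH q E₁ E₂ E₃ A =
      6 * (((prodBernoulli q).real A + (prodBernoulli q).real (E₁ ∪ E₂ ∪ E₃)ᶜ) *
        ((prodBernoulli q).real A * (prodBernoulli q).real (E₁ ∪ E₂ ∪ E₃)ᶜ -
          ((prodBernoulli q).real (E₁ \ A) * (prodBernoulli q).real (E₂ \ A) +
            (prodBernoulli q).real (E₁ \ A) * (prodBernoulli q).real (E₃ \ A) +
            (prodBernoulli q).real (E₂ \ A) * (prodBernoulli q).real (E₃ \ A))) -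
        (prodBernoulli q).real (E₁ \ A) * (prodBernoulli q).real (E₂ \ A) * (prodBernoulli q).real (E₃ \ A)) := by
  unfold lawTriH
  rw [triH_self_eq]
  simp [cellVec]

variable [Fintype ι] [DecidableEq ι]

/-- **One-bond decomposition of the cell vector**: `cellVec p = (1 − p e)·cellVec (p[e↦0]) + (p e)·cellVec (p[e↦1])`. [this work] -/
theorem cellVec_oneBond (p : ι → unitInterval) (E₁ E₂ E₃ A : Set (Set ι)) (e : ι) :
    cellVec p E₁ E₂ E₃ A = fun x =>
      (1 - (p e : ℝ)) * cellVec (Function.update p e 0) E₁ E₂ E₃ A x +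
        (p e : ℝ) * cellVec (Function.update p e 1) E₁ E₂ E₃ A x := by
  have key : ∀ X : Set (Set ι), (prodBernoulli p).real X =
      (1 - (p e : ℝ)) * (prodBernoulli (Function.update p e 0)).real X +
        (p e : ℝ) * (prodBernoulli (Function.update p e 1)).real X :=
    fun X => prodBernoulli_real_oneBond (CovKL.determinedBy_coe_univ X) p (Finset.mem_univ e)
  ext x
  fin_cases x <;> simp [cellVec, key]

/-- **The law-level Bernstein decomposition** of `6H(F, p)` along the coordinate `e` (`t = p e`):
`6H(F,p) = (1−t)³·6H(F∖e) + 3t(1−t)²·h₁ + 3t²(1−t)·h₂ + t³·6H(F/e)` with the mixed trilinear values `h₁, h₂`. [this work] -/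
theorem lawTriH_bernstein (p : ι → unitInterval) (E₁ E₂ E₃ A : Set (Set ι)) (e : ι) :
    lawTriH p E₁ E₂ E₃ A =
      (1 - (p e : ℝ)) ^ 3 * lawTriH (Function.update p e 0) E₁ E₂ E₃ A +
      3 * (p e : ℝ) * (1 - (p e : ℝ)) ^ 2 *
        triH (cellVec (Function.update p e 1) E₁ E₂ E₃ A) (cellVec (Function.update p e 0) E₁ E₂ E₃ A)
          (cellVec (Function.update p e 0) E₁ E₂ E₃ A) +
      3 * (p e : ℝ) ^ 2 * (1 - (p e : ℝ)) *
        triH (cellVec (Function.update p e 1) E₁ E₂ E₃ A) (cellVec (Function.update p e 1) E₁ E₂ E₃ A)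
          (cellVec (Function.update p e 0) E₁ E₂ E₃ A) +
      (p e : ℝ) ^ 3 * lawTriH (Function.update p e 1) E₁ E₂ E₃ A := by
  have h := cellVec_oneBond p E₁ E₂ E₃ A e
  exact triH_bernstein' (cellVec p E₁ E₂ E₃ A) (cellVec (Function.update p e 0) E₁ E₂ E₃ A)
    (cellVec (Function.update p e 1) E₁ E₂ E₃ A) (p e : ℝ) (fun x => congrFun h x)

/-- **THE ONE-STEP LEMMA.**  If along the coordinate `e` the four Bernstein control values are nonnegative — `6H(F ∖ e) ≥ 0`,
`6H(F / e) ≥ 0` (induction hypotheses) and the two MIXED values `triH m₁ m₀ m₀ ≥ 0`, `triH m₁ m₁ m₀ ≥ 0` — then `6H(F, p) ≥ 0`.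
[this work] -/
theorem lawTriH_nonneg_of_step (p : ι → unitInterval) (E₁ E₂ E₃ A : Set (Set ι)) (e : ι)
    (h0 : 0 ≤ lawTriH (Function.update p e 0) E₁ E₂ E₃ A)
    (h1 : 0 ≤ triH (cellVec (Function.update p e 1) E₁ E₂ E₃ A) (cellVec (Function.update p e 0) E₁ E₂ E₃ A)
      (cellVec (Function.update p e 0) E₁ E₂ E₃ A))
    (h2 : 0 ≤ triH (cellVec (Function.update p e 1) E₁ E₂ E₃ A) (cellVec (Function.update p e 1) E₁ E₂ E₃ A)
      (cellVec (Function.update p e 0) E₁ E₂ E₃ A))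
    (h3 : 0 ≤ lawTriH (Function.update p e 1) E₁ E₂ E₃ A) :
    0 ≤ lawTriH p E₁ E₂ E₃ A := by
  rw [lawTriH_bernstein p E₁ E₂ E₃ A e]
  have ht0 : 0 ≤ (p e : ℝ) := (p e).2.1
  have ht1 : (p e : ℝ) ≤ 1 := (p e).2.2
  have ht' : 0 ≤ 1 - (p e : ℝ) := by linarith
  have e1 := mul_nonneg (pow_nonneg ht' 3) h0
  have e2 := mul_nonneg (mul_nonneg (mul_nonneg (by norm_num : (0:ℝ) ≤ 3) ht0) (pow_nonneg ht' 2)) h1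
  have e3 := mul_nonneg (mul_nonneg (mul_nonneg (by norm_num : (0:ℝ) ≤ 3) (pow_nonneg ht0 2)) ht') h2
  have e4 := mul_nonneg (pow_nonneg ht0 3) h3
  linarith

/-! ## The typed conjecture: the law-level one-coordinate inequalities -/

/-- **LAW-LEVEL ONE-STEP INEQUALITIES** (this work; OPEN; the law-level, one-coordinate instance of prim-l12-p2's Conjecture G;
numerically clean on 4 300 random instances and in every fake-law search of the memo §6; PROVED for `{e} ∈ E₁ ∪ E₂ ∪ E₃` in
`…SunflowerLawMarkedPoint`): for every finite three-petal sunflower of up-sets, every `p` and every coordinate `e`, the two mixed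
Bernstein coefficients `triH m₁ m₀ m₀` and `triH m₁ m₁ m₀` (`m₀, m₁` the cell vectors under `p[e↦0]`, `p[e↦1]`) are nonnegative.
Equivalently (`triH_mixed_eq`): `⟨m_{F/e}, ∇H(m_{F∖e})⟩ ≥ 0` and `⟨m_{F∖e}, ∇H(m_{F/e})⟩ ≥ 0`.  Together with `lawTriH_nonneg_of_step`
it gives H-COMB for every finite product measure by induction on the number of non-degenerate coordinates.
An obligation, never a fact: use as `(h : LawMixedNonneg)`. [status: open] -/
@[conjecture] def LawMixedNonneg : Prop :=
  ∀ (ι : Type) [Fintype ι] [DecidableEq ι] (p : ι → unitInterval) (E₁ E₂ E₃ A : Set (Set ι)),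
    IsUpperSet E₁ → IsUpperSet E₂ → IsUpperSet E₃ → E₁ ∩ E₂ = A → E₁ ∩ E₃ = A → E₂ ∩ E₃ = A →
    ∀ e : ι,
      0 ≤ triH (cellVec (Function.update p e 1) E₁ E₂ E₃ A) (cellVec (Function.update p e 0) E₁ E₂ E₃ A)
          (cellVec (Function.update p e 0) E₁ E₂ E₃ A) ∧
      0 ≤ triH (cellVec (Function.update p e 1) E₁ E₂ E₃ A) (cellVec (Function.update p e 1) E₁ E₂ E₃ A)
          (cellVec (Function.update p e 0) E₁ E₂ E₃ A)


/-! ## The reduction: `LawMixedNonneg` implies H-COMB for every finite product measure -/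

open scoped Classical in
/-- Under a `{0,1}`-valued parameter the product measure is the point mass at `S₀ = {i | p i = 1}`: every event has
probability `1` or `0` according to whether it contains `S₀`. [folklore] -/
theorem real_eq_ite_of_zero_one (p : ι → unitInterval) (hp : ∀ i, p i = 0 ∨ p i = 1) (X : Set (Set ι)) :
    (prodBernoulli p).real X = if {i | p i = 1} ∈ X then 1 else 0 := by
  classical
  set S₀ : Set ι := {i | p i = 1} with hS₀
  set F : Finset ι := Finset.univ.filter fun i => p i = 1 with hF
  have hFS : (F : Set ι) = S₀ := by
    ext i; simp [hF, hS₀]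
  -- the two full-probability events `S₀ ⊆ ω` and `ω ∩ S₀ᶜ = ∅`
  have hU : (prodBernoulli p).real {ω : Set ι | (F : Set ι) ⊆ ω} = 1 := by
    rw [prodBernoulli_real_subset]
    refine Finset.prod_eq_one fun i hi => ?_
    have : p i = 1 := (Finset.mem_filter.1 hi).2
    rw [this]; rfl
  have hW : (prodBernoulli p).real {ω : Set ι | ∀ i ∈ Fᶜ, i ∉ ω} = 1 := by
    rw [prodBernoulli_real_forall_notMem]
    refine Finset.prod_eq_one fun i hi => ?_
    have hi' : p i ≠ 1 := by
      intro h1; exact (Finset.mem_compl.1 hi) (Finset.mem_filter.2 ⟨Finset.mem_univ i, h1⟩)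
    rcases hp i with h0 | h1
    · rw [h0]; norm_num
    · exact absurd h1 hi'
  have hsub : {ω : Set ι | (F : Set ι) ⊆ ω} ∩ {ω : Set ι | ∀ i ∈ Fᶜ, i ∉ ω} ⊆ {S₀} := by
    intro ω hω
    rw [Set.mem_singleton_iff]
    ext i
    constructor
    · intro hi
      by_contra hni
      have : i ∈ Fᶜ := by
        rw [Finset.mem_compl]; intro hiF; exact hni (hFS ▸ (Finset.mem_coe.2 hiF))
      exact hω.2 i this hi
    · intro hi
      exact hω.1 (by rw [hFS]; exact hi)
  have mU : MeasurableSet {ω : Set ι | (F : Set ι) ⊆ ω} := MeasurableSet.of_discrete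
  have mW : MeasurableSet {ω : Set ι | ∀ i ∈ Fᶜ, i ∉ ω} := MeasurableSet.of_discrete
  have hone : 1 ≤ (prodBernoulli p).real {S₀} := by
    have h := measureReal_union_add_inter (μ := prodBernoulli p) (s := {ω : Set ι | (F : Set ι) ⊆ ω}) mW
    have hle : (prodBernoulli p).real ({ω : Set ι | (F : Set ι) ⊆ ω} ∪ {ω : Set ι | ∀ i ∈ Fᶜ, i ∉ ω}) ≤ 1 :=
      measureReal_le_one
    have hm := measureReal_mono (μ := prodBernoulli p) hsub
    linarith
  have hS₀ : (prodBernoulli p).real {S₀} = 1 := le_antisymm measureReal_le_one hone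
  split_ifs with hX
  · refine le_antisymm measureReal_le_one ?_
    calc (1 : ℝ) = (prodBernoulli p).real {S₀} := hS₀.symm
      _ ≤ (prodBernoulli p).real X := measureReal_mono (Set.singleton_subset_iff.2 hX)
  · have hXc : X ⊆ {S₀}ᶜ := fun ω hω h => hX (by rw [Set.mem_singleton_iff] at h; exact h ▸ hω)
    have hc : (prodBernoulli p).real {S₀}ᶜ = 1 - (prodBernoulli p).real {S₀} :=
      probReal_compl_eq_one_sub MeasurableSet.of_discrete
    have := measureReal_mono (μ := prodBernoulli p) hXc
    rw [hc, hS₀] at this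
    exact le_antisymm (by linarith) measureReal_nonneg

/-- **Base case**: for a `{0,1}`-valued parameter (a point mass) at most one cell is occupied, so `e₃(c) = 0` and
`6H = 6(a+b)·AG ≥ 0` by Gladkov's inequality. [this work] -/
theorem lawTriH_nonneg_of_zero_one (p : ι → unitInterval) (hp : ∀ i, p i = 0 ∨ p i = 1) {A E₁ E₂ E₃ : Set (Set ι)}
    (h₁ : IsUpperSet E₁) (h₂ : IsUpperSet E₂) (h₃ : IsUpperSet E₃)
    (h12 : E₁ ∩ E₂ = A) (h13 : E₁ ∩ E₃ = A) (h23 : E₂ ∩ E₃ = A) : 0 ≤ lawTriH p E₁ E₂ E₃ A := by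
  classical
  rw [lawTriH_eq]
  have hAG := prodBernoulli_strongHarris_sunflower_three p h₁ h₂ h₃ h12 h13 h23
  have ha : 0 ≤ (prodBernoulli p).real A := measureReal_nonneg
  have hb : 0 ≤ (prodBernoulli p).real (E₁ ∪ E₂ ∪ E₃)ᶜ := measureReal_nonneg
  have hc₃ : 0 ≤ (prodBernoulli p).real (E₃ \ A) := measureReal_nonneg
  have h12' : (prodBernoulli p).real (E₁ \ A) * (prodBernoulli p).real (E₂ \ A) = 0 := by
    rw [real_eq_ite_of_zero_one p hp, real_eq_ite_of_zero_one p hp]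
    split_ifs with hx1 hx2
    · exfalso
      have : {i | p i = 1} ∈ A := by rw [← h12]; exact ⟨hx1.1, hx2.1⟩
      exact hx1.2 this
    all_goals simp
  have he3 : (prodBernoulli p).real (E₁ \ A) * (prodBernoulli p).real (E₂ \ A) * (prodBernoulli p).real (E₃ \ A) = 0 := by
    rw [h12']; ring
  nlinarith [mul_nonneg (add_nonneg ha hb) (sub_nonneg.2 hAG)]

/-- The set of NON-DEGENERATE coordinates (`p i ∉ {0, 1}`) shrinks when a coordinate is frozen at `0` or `1`. [this work] -/
theorem card_filter_update_lt (p : ι → unitInterval) {e : ι} (he : p e ≠ 0 ∧ p e ≠ 1) (v : unitInterval)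
    (hv : v = 0 ∨ v = 1) :
    (Finset.univ.filter fun i => Function.update p e v i ≠ 0 ∧ Function.update p e v i ≠ 1).card <
      (Finset.univ.filter fun i => p i ≠ 0 ∧ p i ≠ 1).card := by
  classical
  apply Finset.card_lt_card
  rw [Finset.ssubset_iff_of_subset]
  · refine ⟨e, Finset.mem_filter.2 ⟨Finset.mem_univ e, he⟩, ?_⟩
    intro hmem
    have h := (Finset.mem_filter.1 hmem).2
    simp only [Function.update_self] at h
    rcases hv with hv | hv
    · exact h.1 hv
    · exact h.2 hv
  · intro i hi
    have h := (Finset.mem_filter.1 hi).2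
    by_cases hie : i = e
    · subst hie
      simp only [Function.update_self] at h
      rcases hv with hv | hv
      · exact absurd hv h.1
      · exact absurd hv h.2
    · rw [Function.update_of_ne hie] at h
      exact Finset.mem_filter.2 ⟨Finset.mem_univ i, h⟩

/-- **THE REDUCTION.**  The law-level one-step inequalities `LawMixedNonneg` imply H-COMB — `6H(F, p) ≥ 0` for every
three-petal sunflower of up-sets of a finite cube and every product measure — by induction on the number of non-degenerate
coordinates, using `lawTriH_nonneg_of_step` (step) and `lawTriH_nonneg_of_zero_one` (point-mass base). [this work] -/
theorem lawTriH_nonneg_of_mixedNonneg (hmix : LawMixedNonneg) {ι : Type} [Fintype ι] [DecidableEq ι]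
    (p : ι → unitInterval) {A E₁ E₂ E₃ : Set (Set ι)}
    (h₁ : IsUpperSet E₁) (h₂ : IsUpperSet E₂) (h₃ : IsUpperSet E₃)
    (h12 : E₁ ∩ E₂ = A) (h13 : E₁ ∩ E₃ = A) (h23 : E₂ ∩ E₃ = A) : 0 ≤ lawTriH p E₁ E₂ E₃ A := by
  classical
  -- strong induction on the number of non-degenerate coordinates
  suffices key : ∀ n : ℕ, ∀ q : ι → unitInterval,
      (Finset.univ.filter fun i => q i ≠ 0 ∧ q i ≠ 1).card ≤ n → 0 ≤ lawTriH q E₁ E₂ E₃ A from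
    key _ p le_rfl
  intro n
  induction n with
  | zero =>
    intro q hq
    refine lawTriH_nonneg_of_zero_one q (fun i => ?_) h₁ h₂ h₃ h12 h13 h23
    by_contra hcon
    have hcon' : q i ≠ 0 ∧ q i ≠ 1 := not_or.1 hcon
    have : i ∈ Finset.univ.filter fun i => q i ≠ 0 ∧ q i ≠ 1 := Finset.mem_filter.2 ⟨Finset.mem_univ i, hcon'⟩
    rw [Nat.le_zero, Finset.card_eq_zero] at hq
    rw [hq] at this
    exact absurd this (Finset.notMem_empty i)
  | succ n ih =>
    intro q hq
    by_cases hdeg : (Finset.univ.filter fun i => q i ≠ 0 ∧ q i ≠ 1).card ≤ n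
    · exact ih q hdeg
    · -- pick a non-degenerate coordinate `e` and run the one-step lemma there
      have hpos : 0 < (Finset.univ.filter fun i => q i ≠ 0 ∧ q i ≠ 1).card := by omega
      obtain ⟨e, he⟩ := Finset.card_pos.1 hpos
      have he' : q e ≠ 0 ∧ q e ≠ 1 := (Finset.mem_filter.1 he).2
      have c0 := card_filter_update_lt q he' 0 (Or.inl rfl)
      have c1 := card_filter_update_lt q he' 1 (Or.inr rfl)
      have ih0 := ih (Function.update q e 0) (by omega)
      have ih1 := ih (Function.update q e 1) (by omega)
      obtain ⟨m1, m2⟩ := hmix ι q E₁ E₂ E₃ A h₁ h₂ h₃ h12 h13 h23 e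
      exact lawTriH_nonneg_of_step q E₁ E₂ E₃ A e ih0 m1 m2 ih1

/-- **H-COMB from the one-step inequalities, in the lane's cell notation**: `LawMixedNonneg` implies
`(a + b)(ab − (c₁c₂ + c₁c₃ + c₂c₃)) ≥ c₁c₂c₃` for every three-petal sunflower of up-sets of a finite cube and every `p`
(the statement shape of prove-1's `PrincipalCore.lawH_nonneg`, there proved unconditionally on the principal-core stratum). [this work] -/
theorem lawH_nonneg_of_mixedNonneg (hmix : LawMixedNonneg) {ι : Type} [Fintype ι] [DecidableEq ι]
    (p : ι → unitInterval) {A E₁ E₂ E₃ : Set (Set ι)}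
    (h₁ : IsUpperSet E₁) (h₂ : IsUpperSet E₂) (h₃ : IsUpperSet E₃)
    (h12 : E₁ ∩ E₂ = A) (h13 : E₁ ∩ E₃ = A) (h23 : E₂ ∩ E₃ = A) :
    0 ≤ ((prodBernoulli p).real A + (prodBernoulli p).real (E₁ ∪ E₂ ∪ E₃)ᶜ) *
        ((prodBernoulli p).real A * (prodBernoulli p).real (E₁ ∪ E₂ ∪ E₃)ᶜ -
          ((prodBernoulli p).real (E₁ \ A) * (prodBernoulli p).real (E₂ \ A) +
            (prodBernoulli p).real (E₁ \ A) * (prodBernoulli p).real (E₃ \ A) +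
            (prodBernoulli p).real (E₂ \ A) * (prodBernoulli p).real (E₃ \ A))) -
      (prodBernoulli p).real (E₁ \ A) * (prodBernoulli p).real (E₂ \ A) * (prodBernoulli p).real (E₃ \ A) := by
  have h := lawTriH_nonneg_of_mixedNonneg hmix p h₁ h₂ h₃ h12 h13 h23
  rw [lawTriH_eq] at h
  linarith

end LawOneStep

end Summit.CriticalPhenomena.PercolationContinuityZ3.Theorems.SunflowerPartition

end
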